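import Literature.NumberTheory.Sieve.SmoothMajorantFourier
import Mathlib.Analysis.Fourier.FourierTransformDeriv
import Mathlib.Analysis.SpecialFunctions.ImproperIntegrals
import Mathlib.MeasureTheory.Integral.Prod
import HarnessLib

/-!
# Local input for the smooth linear forms estimate (Conlon–Fox–Zhao §9): the `c_χ` integral (9.11)

Trunk T-SIEVE. D. Conlon, J. Fox, Y. Zhao, *The Green–Tao theorem: an exposition*
(arXiv:1403.2957), §9, p. 18, (9.11): the double integral
`∫_ℝ ∫_ℝ φ(ξ)φ(ξ') (1+iξ)(1+iξ')/(2 + i(ξ+ξ')) dξ dξ' = ∫_0^∞ χ'(x)² dx = c_χ`.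
In Mathlib's normalisation (`a(η) = 1 - 2πiη`, `φ = 𝓕(e^x χ)`), this file proves the Fourier-side
identities behind it without differentiating under the integral sign:

* `deriv_eq_zero_of_one_le_abs` (`χ' = 0` on `|x| ≥ 1`), `contDiff_deriv_cutoff`;
* `aF_mul_phiF` : `(1 - 2πiη) φ(η) = -𝓕(e^x χ')(η)` (from `𝓕(g') = 2πiη 𝓕 g`, `g' = g + e^x χ'`);
* `integral_aF_phiF_exp` : `∫ (1-2πiη) φ(η) e^{-(1-2πiη)x} dη = -χ'(x)` (Fourier inversion for `e^x χ'`).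

## References
* D. Conlon, J. Fox, Y. Zhao, EMS Surv. Math. Sci. 1 (2014), 249–282, §9 (p. 18, (9.11)).
  [cite: ConlonFoxZhao2014]
-/

noncomputable section

open MeasureTheory Real FourierTransform Complex
open scoped FourierTransform

namespace Literature.NumberTheory.Sieve.CFZ

/-- `a(η) = 1 - 2πiη` (so that `zOf R η = a(η)/log R`). [cite: ConlonFoxZhao2014, Section 9] -/
def aF (η : ℝ) : ℂ := 1 - 2 * π * η * I

section Cutoff

variable {χ : ℝ → ℝ} (hs : ContDiff ℝ (⊤ : ℕ∞) χ) (hsupp : ∀ x, 1 ≤ |x| → χ x = 0)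
include hs hsupp

/-- `χ' = 0` on `|x| ≥ 1` (one-sided uniqueness of the derivative on `[x, ∞)` resp. `(-∞, x]`).
[cite: ConlonFoxZhao2014, Section 9] -/
theorem deriv_eq_zero_of_one_le_abs (x : ℝ) (hx : 1 ≤ |x|) : deriv χ x = 0 := by
  have hd : HasDerivAt χ (deriv χ x) x :=
    ((hs.differentiable (by simp)).differentiableAt).hasDerivAt
  rcases le_abs'.1 hx with h | h
  · -- `x ≤ -1`: `χ = 0` on `(-∞, x]`
    have h0 : HasDerivWithinAt χ 0 (Set.Iic x) x := by
      refine (hasDerivWithinAt_const x (Set.Iic x) (0 : ℝ)).congr_of_mem (fun y hy => ?_) Set.self_mem_Iic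
      exact hsupp y (by rw [abs_of_nonpos (by linarith [Set.mem_Iic.1 hy])]; linarith [Set.mem_Iic.1 hy])
    exact (uniqueDiffWithinAt_Iic x).eq_deriv _ hd.hasDerivWithinAt h0
  · -- `1 ≤ x`: `χ = 0` on `[x, ∞)`
    have h0 : HasDerivWithinAt χ 0 (Set.Ici x) x := by
      refine (hasDerivWithinAt_const x (Set.Ici x) (0 : ℝ)).congr_of_mem (fun y hy => ?_) Set.self_mem_Ici
      exact hsupp y (by rw [abs_of_nonneg (by linarith [Set.mem_Ici.1 hy])]; exact h.trans (Set.mem_Ici.1 hy))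
    exact (uniqueDiffWithinAt_Ici x).eq_deriv _ hd.hasDerivWithinAt h0

omit hsupp in
/-- `χ'` is smooth. [cite: ConlonFoxZhao2014, Section 9] -/
theorem contDiff_deriv_cutoff : ContDiff ℝ (⊤ : ℕ∞) (deriv χ) :=
  (contDiff_infty_iff_deriv.1 hs).2

omit hsupp in
/-- The derivative of `g = e^x χ`: `g' = g + e^x χ'`. [cite: ConlonFoxZhao2014, Section 9] -/
theorem hasDerivAt_expCutoff (x : ℝ) :
    HasDerivAt (expCutoff χ) (expCutoff χ x + expCutoff (deriv χ) x) x := by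
  have hχ : HasDerivAt χ (deriv χ x) x := ((hs.differentiable (by simp)).differentiableAt).hasDerivAt
  have h := ((Real.hasDerivAt_exp x).mul hχ).ofReal_comp
  refine h.congr_deriv ?_
  simp only [expCutoff]
  push_cast
  ring

omit hsupp in
/-- `deriv g = g + e^x χ'`. [cite: ConlonFoxZhao2014, Section 9] -/
theorem deriv_expCutoff : deriv (expCutoff χ) = fun x => expCutoff χ x + expCutoff (deriv χ) x :=
  funext fun x => (hasDerivAt_expCutoff hs x).deriv

/-- **`(1 - 2πiη) φ(η) = -𝓕(e^x χ')(η)`** (Fourier transform of a derivative).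
[cite: ConlonFoxZhao2014, Section 9] -/
theorem aF_mul_phiF (η : ℝ) : aF η * phiF χ η = -phiF (deriv χ) η := by
  have hs' := contDiff_deriv_cutoff hs
  have hsupp' := deriv_eq_zero_of_one_le_abs hs hsupp
  -- integrability of `g`, `g'`, differentiability of `g`
  have hgi : Integrable (expCutoff χ) := by
    have := (expCutoffS hs hsupp).integrable (μ := volume); simpa using this
  have hg'i : Integrable (expCutoff (deriv χ)) := by
    have := (expCutoffS hs' hsupp').integrable (μ := volume); simpa using this
  have hgd : Differentiable ℝ (expCutoff χ) := fun x => (hasDerivAt_expCutoff hs x).differentiableAt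
  have hderi : Integrable (deriv (expCutoff χ)) := by
    rw [deriv_expCutoff hs]; exact hgi.add hg'i
  -- `𝓕(g') = 2πiη 𝓕 g` and `𝓕(g') = 𝓕 g + 𝓕(e^x χ')`
  have h1 := congrFun (Real.fourier_deriv hgi hgd hderi) η
  have h2 : 𝓕 (deriv (expCutoff χ)) η = phiF χ η + phiF (deriv χ) η := by
    rw [deriv_expCutoff hs]
    simp only [phiF, Real.fourier_eq]
    rw [← integral_add ((Real.fourierIntegral_convergent_iff η).2 hgi)
      ((Real.fourierIntegral_convergent_iff η).2 hg'i)]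
    exact integral_congr_ae (Filter.Eventually.of_forall fun v => smul_add _ _ _)
  rw [h2, smul_eq_mul] at h1
  simp only [aF, phiF] at h1 ⊢
  linear_combination h1

/-- **`∫ (1-2πiη) φ(η) e^{-(1-2πiη)x} dη = -χ'(x)`**: the function `G` of the `c_χ` computation
(Fourier inversion for `e^x χ'`). [cite: ConlonFoxZhao2014, Section 9] -/
theorem integral_aF_phiF_exp (x : ℝ) :
    ∫ η : ℝ, aF η * phiF χ η * Complex.exp (-(aF η) * x) = -((deriv χ x : ℝ) : ℂ) := by
  have hs' := contDiff_deriv_cutoff hs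
  have hsupp' := deriv_eq_zero_of_one_le_abs hs hsupp
  have hinv := expCutoff_eq_fourierInv hs' hsupp' x
  -- `e^{-a x} = e^{-x} e^{2πiηx}`
  have hexp : ∀ η : ℝ, Complex.exp (-(aF η) * x) = Complex.exp (-x) * Complex.exp (2 * π * (η * x) * I) := by
    intro η; rw [← Complex.exp_add]; congr 1; simp only [aF]; ring
  calc ∫ η : ℝ, aF η * phiF χ η * Complex.exp (-(aF η) * x)
      = ∫ η : ℝ, -Complex.exp (-x) * (phiF (deriv χ) η * Complex.exp (2 * π * (η * x) * I)) := by
        refine integral_congr_ae (Filter.Eventually.of_forall fun η => ?_)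
        simp only [aF_mul_phiF hs hsupp η, hexp η]; ring
    _ = -Complex.exp (-x) * expCutoff (deriv χ) x := by rw [integral_const_mul, ← hinv]
    _ = -((deriv χ x : ℝ) : ℂ) := by
        simp only [expCutoff]
        push_cast
        rw [neg_mul, ← mul_assoc, ← Complex.ofReal_neg, ← Complex.ofReal_exp, ← Complex.ofReal_exp,
          ← Complex.ofReal_mul, ← Real.exp_add, neg_add_cancel, Real.exp_zero]
        simp

/-! ### The double integral (CFZ (9.11)) -/

/-- `ψ = a φ` is integrable (it is `-𝓕(e^x χ')`, a Schwartz function). [cite: ConlonFoxZhao2014, Section 9] -/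
theorem integrable_aF_mul_phiF : Integrable fun η : ℝ => aF η * phiF χ η := by
  have hs' := contDiff_deriv_cutoff hs
  have hsupp' := deriv_eq_zero_of_one_le_abs hs hsupp
  have h := (phiF_integrable hs' hsupp').neg
  refine h.congr (Filter.Eventually.of_forall fun η => ?_)
  simp [aF_mul_phiF hs hsupp η]

omit hs hsupp in
/-- `|e^{-a(η)x}| = e^{-x}`. [cite: ConlonFoxZhao2014, Section 9] -/
theorem norm_exp_neg_aF_mul (η x : ℝ) : ‖Complex.exp (-(aF η) * x)‖ = Real.exp (-x) := by
  rw [Complex.norm_exp]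
  congr 1
  simp [aF]

omit hs hsupp in
/-- `1/(a(η) + a(η')) = ∫_0^∞ e^{-a(η)x} e^{-a(η')x} dx` (`Re(a + a') = 2 > 0`).
[cite: ConlonFoxZhao2014, Section 9] -/
theorem inv_aF_add_aF_eq_integral (η η' : ℝ) :
    (aF η + aF η')⁻¹ = ∫ x in Set.Ioi (0 : ℝ), Complex.exp (-(aF η) * x) * Complex.exp (-(aF η') * x) := by
  have hre : (-(aF η + aF η')).re < 0 := by simp [aF]
  have h := integral_exp_mul_complex_Ioi hre 0
  simp only [Complex.ofReal_zero, mul_zero, Complex.exp_zero] at h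
  rw [show (fun x : ℝ => Complex.exp (-(aF η) * x) * Complex.exp (-(aF η') * x)) =
      fun x : ℝ => Complex.exp (-(aF η + aF η') * x) from funext fun x => by rw [← Complex.exp_add]; ring_nf, h]
  have hne : aF η + aF η' ≠ 0 := fun h0 => by
    have := congrArg Complex.re h0; simp [aF] at this
  field_simp

/-- Fubini #1: for fixed `η`,
`∫ ψ(η') (∫_0^∞ e^{-a x} e^{-a' x} dx) dη' = ∫_0^∞ e^{-a(η) x} (-χ'(x)) dx`.
[cite: ConlonFoxZhao2014, Section 9] -/
theorem integral_psi_inv_eq (η : ℝ) :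
    ∫ η' : ℝ, aF η' * phiF χ η' * (aF η + aF η')⁻¹ =
      ∫ x in Set.Ioi (0 : ℝ), Complex.exp (-(aF η) * x) * -((deriv χ x : ℝ) : ℂ) := by
  have hψ := integrable_aF_mul_phiF hs hsupp
  -- the integrand of the double integral and its dominator
  set F : ℝ → ℝ → ℂ := fun η' x => aF η' * phiF χ η' * (Complex.exp (-(aF η) * x) * Complex.exp (-(aF η') * x))
    with hF
  have hFint : Integrable (Function.uncurry F) (volume.prod (volume.restrict (Set.Ioi (0 : ℝ)))) := by
    have hdom : Integrable (fun z : ℝ × ℝ => ‖aF z.1 * phiF χ z.1‖ * Real.exp (-2 * z.2))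
        (volume.prod (volume.restrict (Set.Ioi (0 : ℝ)))) := by
      have h2 := exp_neg_integrableOn_Ioi 0 (b := 2) (by norm_num)
      exact hψ.norm.mul_prod h2
    refine hdom.mono' ?_ (Filter.Eventually.of_forall fun z => ?_)
    · have hc : Continuous (Function.uncurry F) := by
        have hφc : Continuous (phiF χ) := by rw [← phiS_coe hs hsupp]; exact (phiS hs hsupp).continuous
        simp only [hF, Function.uncurry_def, aF]
        fun_prop
      exact hc.aestronglyMeasurable
    · obtain ⟨η', x⟩ := z
      simp only [Function.uncurry_apply_pair, hF, norm_mul, norm_exp_neg_aF_mul]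
      rw [mul_assoc, ← Real.exp_add, show -x + -x = -2 * x by ring, mul_assoc]
  calc ∫ η' : ℝ, aF η' * phiF χ η' * (aF η + aF η')⁻¹
      = ∫ η' : ℝ, ∫ x in Set.Ioi (0 : ℝ), F η' x := by
        refine integral_congr_ae (Filter.Eventually.of_forall fun η' => ?_)
        simp only [hF, inv_aF_add_aF_eq_integral, ← integral_const_mul]
    _ = ∫ x in Set.Ioi (0 : ℝ), ∫ η' : ℝ, F η' x := integral_integral_swap hFint
    _ = ∫ x in Set.Ioi (0 : ℝ), Complex.exp (-(aF η) * x) * -((deriv χ x : ℝ) : ℂ) := by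
        refine integral_congr_ae (Filter.Eventually.of_forall fun x => ?_)
        simp only [hF]
        rw [← integral_aF_phiF_exp hs hsupp x, ← integral_const_mul]
        refine integral_congr_ae (Filter.Eventually.of_forall fun η' => ?_)
        ring

/-- **CFZ (9.11) in Mathlib's normalisation**:
`∫_ℝ ∫_ℝ φ(η) φ(η') (1-2πiη)(1-2πiη')/(2 - 2πi(η+η')) dη dη' = ∫_0^∞ χ'(x)² dx`.
[cite: ConlonFoxZhao2014, Section 9, equation (9.11)] -/
theorem integral_integral_phiF_kernel :
    ∫ η : ℝ, ∫ η' : ℝ, phiF χ η * phiF χ η' *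
        ((1 - 2 * π * η * I) * (1 - 2 * π * η' * I) / (2 - 2 * π * (η + η') * I)) =
      ((∫ x in Set.Ioi (0 : ℝ), (deriv χ x) ^ 2 : ℝ) : ℂ) := by
  have hψ := integrable_aF_mul_phiF hs hsupp
  have hs' := contDiff_deriv_cutoff hs
  have hsupp' := deriv_eq_zero_of_one_le_abs hs hsupp
  -- Step 1: inner integral via Fubini #1
  have h1 : ∀ η : ℝ, ∫ η' : ℝ, phiF χ η * phiF χ η' *
      ((1 - 2 * π * η * I) * (1 - 2 * π * η' * I) / (2 - 2 * π * (η + η') * I)) =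
      aF η * phiF χ η * ∫ x in Set.Ioi (0 : ℝ), Complex.exp (-(aF η) * x) * -((deriv χ x : ℝ) : ℂ) := by
    intro η
    rw [← integral_psi_inv_eq hs hsupp η, ← integral_const_mul]
    refine integral_congr_ae (Filter.Eventually.of_forall fun η' => ?_)
    have : (2 : ℂ) - 2 * π * (η + η') * I = aF η + aF η' := by simp only [aF]; ring
    show phiF χ η * phiF χ η' * ((1 - 2 * π * η * I) * (1 - 2 * π * η' * I) / (2 - 2 * π * (η + η') * I)) =
      aF η * phiF χ η * (aF η' * phiF χ η' * (aF η + aF η')⁻¹)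
    rw [this, div_eq_mul_inv]
    simp only [aF]
    ring
  simp_rw [h1]
  -- Step 2: Fubini #2 on `(η, x)`
  have hχ'c : Continuous (deriv χ) := hs.continuous_deriv (by simp)
  have hχ'supp : HasCompactSupport (deriv χ) := by
    refine HasCompactSupport.intro (isCompact_Icc (a := (-1 : ℝ)) (b := 1)) fun x hx => hsupp' x ?_
    rw [Set.mem_Icc, not_and_or, not_le, not_le] at hx
    rcases hx with h | h
    · rw [abs_of_neg (by linarith)]; linarith
    · rw [abs_of_pos (by linarith)]; linarith
  have hχ'i : Integrable (fun x => ((deriv χ x : ℝ) : ℂ)) (volume.restrict (Set.Ioi (0 : ℝ))) :=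
    ((hχ'c.integrable_of_hasCompactSupport hχ'supp).ofReal).integrableOn
  set F : ℝ → ℝ → ℂ := fun η x => aF η * phiF χ η * (Complex.exp (-(aF η) * x) * -((deriv χ x : ℝ) : ℂ))
    with hF
  have hex : Integrable (fun x : ℝ => ((Real.exp (-x) : ℝ) : ℂ) * ((deriv χ x : ℝ) : ℂ))
      (volume.restrict (Set.Ioi (0 : ℝ))) := by
    refine hχ'i.bdd_mul (c := 1) (by fun_prop) ?_
    refine (ae_restrict_iff' measurableSet_Ioi).2 (Filter.Eventually.of_forall fun x hx => ?_)
    rw [Complex.norm_real, Real.norm_eq_abs, abs_of_pos (Real.exp_pos _), Real.exp_le_one_iff]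
    linarith [Set.mem_Ioi.1 hx]
  have hFint : Integrable (Function.uncurry F) (volume.prod (volume.restrict (Set.Ioi (0 : ℝ)))) := by
    have hdom : Integrable (fun z : ℝ × ℝ => ‖aF z.1 * phiF χ z.1‖ *
        ‖((Real.exp (-z.2) : ℝ) : ℂ) * ((deriv χ z.2 : ℝ) : ℂ)‖)
        (volume.prod (volume.restrict (Set.Ioi (0 : ℝ)))) := hψ.norm.mul_prod hex.norm
    refine hdom.mono' ?_ (Filter.Eventually.of_forall fun z => ?_)
    · have hc : Continuous (Function.uncurry F) := by
        have hφc : Continuous (phiF χ) := by rw [← phiS_coe hs hsupp]; exact (phiS hs hsupp).continuous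
        simp only [hF, Function.uncurry_def, aF]
        fun_prop
      exact hc.aestronglyMeasurable
    · obtain ⟨η, x⟩ := z
      simp only [Function.uncurry_apply_pair, hF, norm_mul, norm_neg, norm_exp_neg_aF_mul,
        Complex.norm_real, Real.norm_eq_abs, abs_of_pos (Real.exp_pos _)]
      exact le_of_eq (by ring)
  calc ∫ η : ℝ, aF η * phiF χ η * ∫ x in Set.Ioi (0 : ℝ), Complex.exp (-(aF η) * x) * -((deriv χ x : ℝ) : ℂ)
      = ∫ η : ℝ, ∫ x in Set.Ioi (0 : ℝ), F η x := by
        refine integral_congr_ae (Filter.Eventually.of_forall fun η => ?_)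
        simp only [hF, ← integral_const_mul]
    _ = ∫ x in Set.Ioi (0 : ℝ), ∫ η : ℝ, F η x := integral_integral_swap hFint
    _ = ∫ x in Set.Ioi (0 : ℝ), (((deriv χ x) ^ 2 : ℝ) : ℂ) := by
        refine integral_congr_ae (Filter.Eventually.of_forall fun x => ?_)
        simp only [hF]
        have : ∀ η : ℝ, aF η * phiF χ η * (Complex.exp (-(aF η) * x) * -((deriv χ x : ℝ) : ℂ)) =
            -((deriv χ x : ℝ) : ℂ) * (aF η * phiF χ η * Complex.exp (-(aF η) * x)) := fun η => by ring
        simp_rw [this]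
        rw [integral_const_mul, integral_aF_phiF_exp hs hsupp x]
        push_cast
        ring
    _ = ((∫ x in Set.Ioi (0 : ℝ), (deriv χ x) ^ 2 : ℝ) : ℂ) := integral_complex_ofReal

end Cutoff

end Literature.NumberTheory.Sieve.CFZ
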